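import Literature.ModelTheory.FiniteModelTheory.CFI
import HarnessLib

/-!
# Local structure of the uncoloured CFI graphs `CFI(G, T)`: adjacency, degrees, six-cycles

Topic `Literature/ModelTheory/FiniteModelTheory`; support for the discharge of
`ChenFlumLiu2025_ptime_separation` (`CFIUncoloured.lean`, Chen–Flum–Liu 2025, Thm. 8.1: the
even and the odd uncoloured CFI graphs are separated in polynomial time). The separating
algorithm (`CFIParitySeparator.lean`) must RECOGNISE the gadgets of the uncoloured graph; as in
the source (§8: "`x ∼ y` iff `deg(x), deg(y) ≥ 3` and `x` and `y` are on a cycle of length at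
most eight", Lemma 3.1, Lemma 7.12) this is done through short cycles. We use cycles of length
EXACTLY SIX through an EDGE, which suffices and keeps the case analysis local:

* the vertices of `cfiGraph G T` (`CFI.lean`): middle vertices `inl ⟨u, S⟩` (`S ⊆ N(u)` even)
  and link vertices `inr (⟨(u, w), _⟩, c)` (`c = true`: `a(u,w)`, `c = false`: `b(u,w)`); the
  CONNECTION partner `conn` of a link (`(w, u, c ⊕ [uw ∈ T])`), an involution;
* complete adjacency inversion (`cfiGraph_adj_inl_iff`, `cfiGraph_adj_inr_iff`): a middle
  vertex of `u` is adjacent exactly to one link of `u` per neighbour of `u`; a link is adjacent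
  to the middle vertices of its own gadget with the matching bit and to its connection partner;
* degrees: middle vertices have the degree of their base vertex; vertices of gadgets over base
  vertices of degree `≥ 3` have degree `≥ 3`, over base vertices of degree `≤ 2` degree `≤ 2`,
  with the exact neighbourhoods over base vertices of degree `1` and `2` (the leaf gadget has the
  two dead ends `a(u,w)` and `m(u, ∅)`);
* SIX-CYCLES (`SixCycleThrough`): every gadget edge over a base vertex of degree `≥ 3` lies on a
  six-cycle inside its gadget (`sixCycleThrough_gadget`), whereas no connection edge
  (`not_sixCycleThrough_conn`) and no gadget edge over a base vertex of degree `≤ 2`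
  (`not_sixCycleThrough_gadget_of_degree_le_two`) lies on a six-cycle (cf. Lemma 3.1 of the
  source: `Y(1)`, `Y(2)` contain no cycle; and Lemma 7.12: short cycles stay inside a gadget).

## References

* [ChenFlumLiu2025] Y. Chen, J. Flum, M. Liu, *Some remarks on the uncolored versions of the
  original CFI-graphs*, arXiv:2507.01459 (2025), §3 (3.1)–(3.3), Lemma 3.1, Lemma 7.12, §8.
* [CaiFurerImmerman1992] J.-Y. Cai, M. Fürer, N. Immerman, Combinatorica 12 (1992), §6.
-/

namespace Literature.ModelTheory.FiniteModelTheory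

open Finset

/-! ### Six-cycles through an ordered edge (generic) -/

section SixCycle

variable {V : Type*} (Z : SimpleGraph V)

/-- `SixCycleThrough Z x y`: there is a cycle of length six `x, y, v₂, v₃, v₄, v₅, x` in `Z`
(six pairwise distinct vertices; the adjacency `x ~ y` itself is not required). [folklore] -/
def SixCycleThrough (x y : V) : Prop :=
  ∃ v₂ v₃ v₄ v₅ : V, Z.Adj y v₂ ∧ Z.Adj v₂ v₃ ∧ Z.Adj v₃ v₄ ∧ Z.Adj v₄ v₅ ∧ Z.Adj v₅ x ∧
    [x, y, v₂, v₃, v₄, v₅].Nodup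

/-- `SixCycleThrough` is decidable on a finite graph. [folklore] -/
instance [Fintype V] [DecidableEq V] [DecidableRel Z.Adj] (x y : V) : Decidable (SixCycleThrough Z x y) := by
  unfold SixCycleThrough
  infer_instance

variable {Z}

/-- Reversing a six-cycle. [folklore] -/
theorem SixCycleThrough.symm {x y : V} (h : SixCycleThrough Z x y) : SixCycleThrough Z y x := by
  obtain ⟨v₂, v₃, v₄, v₅, h₁, h₂, h₃, h₄, h₅, hnd⟩ := h
  refine ⟨v₅, v₄, v₃, v₂, h₅.symm, h₄.symm, h₃.symm, h₂.symm, h₁.symm, ?_⟩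
  simp only [List.nodup_cons, List.mem_cons, List.not_mem_nil, or_false, not_or, List.nodup_nil,
    and_true, not_false_eq_true] at hnd ⊢
  obtain ⟨⟨hxy, hx2, hx3, hx4, hx5⟩, ⟨hy2, hy3, hy4, hy5⟩, ⟨h23, h24, h25⟩, ⟨h34, h35⟩, h45⟩ := hnd
  exact ⟨⟨Ne.symm hxy, hy5, hy4, hy3, hy2⟩, ⟨hx5, hx4, hx3, hx2⟩, ⟨Ne.symm h45, Ne.symm h35, Ne.symm h25⟩,
    ⟨Ne.symm h34, Ne.symm h24⟩, Ne.symm h23⟩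

/-- `SixCycleThrough` is symmetric. [folklore] -/
theorem sixCycleThrough_comm {x y : V} : SixCycleThrough Z x y ↔ SixCycleThrough Z y x :=
  ⟨SixCycleThrough.symm, SixCycleThrough.symm⟩

end SixCycle

/-! ### Toggling membership (to build even subsets) -/

section Toggle

variable {α : Type*} [DecidableEq α]

/-- Toggle the membership of `a` in `S`. [folklore] -/
def toggle (S : Finset α) (a : α) : Finset α := if a ∈ S then S.erase a else insert a S

/-- Membership in a toggled set. [folklore] -/
theorem mem_toggle {S : Finset α} {a x : α} : x ∈ toggle S a ↔ (x ∈ S ↔ x ≠ a) := by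
  unfold toggle
  split_ifs with h
  · rw [mem_erase]
    constructor
    · rintro ⟨hne, hx⟩; exact ⟨fun _ => hne, fun _ => hx⟩
    · intro hx
      by_cases hxa : x = a
      · exact absurd (hxa ▸ h) (fun hh => (hx.mp hh) hxa)
      · exact ⟨hxa, hx.mpr hxa⟩
  · rw [mem_insert]
    constructor
    · rintro (rfl | hx)
      · exact ⟨fun hh => absurd hh h, fun hh => absurd rfl hh⟩
      · exact ⟨fun _ => fun hxa => h (hxa ▸ hx), fun _ => hx⟩
    · intro hx
      by_cases hxa : x = a
      · exact Or.inl hxa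
      · exact Or.inr (hx.mpr hxa)

/-- Membership of another element is unchanged. [folklore] -/
theorem mem_toggle_of_ne {S : Finset α} {a x : α} (h : x ≠ a) : x ∈ toggle S a ↔ x ∈ S := by
  rw [mem_toggle]
  exact ⟨fun hx => hx.mpr h, fun hx => ⟨fun _ => h, fun _ => hx⟩⟩

/-- Membership of the toggled element is flipped. [folklore] -/
theorem mem_toggle_self {S : Finset α} {a : α} : a ∈ toggle S a ↔ a ∉ S := by
  rw [mem_toggle]
  exact ⟨fun h hS => (h.mp hS) rfl, fun h => ⟨fun hS => absurd hS h, fun hh => absurd rfl hh⟩⟩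

/-- Toggling changes the cardinality by one, hence flips its parity. [folklore] -/
theorem even_card_toggle {S : Finset α} {a : α} : Even (toggle S a).card ↔ ¬ Even S.card := by
  unfold toggle
  split_ifs with h
  · rw [card_erase_of_mem h]
    have := card_pos.mpr ⟨a, h⟩
    rw [Nat.even_sub (by omega)]
    simp
  · rw [card_insert_of_notMem h, Nat.even_add_one]

/-- Toggling twice preserves the parity of the cardinality. [folklore] -/
theorem even_card_toggle_toggle {S : Finset α} {a b : α} :
    Even (toggle (toggle S a) b).card ↔ Even S.card := by
  rw [even_card_toggle, even_card_toggle, not_not]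

/-- Toggling inside a superset stays inside. [folklore] -/
theorem toggle_subset {S N : Finset α} {a : α} (hS : S ⊆ N) (ha : a ∈ N) : toggle S a ⊆ N := by
  intro x hx
  by_cases hxa : x = a
  · exact hxa ▸ ha
  · exact hS ((mem_toggle_of_ne hxa).mp hx)

end Toggle

/-! ### Vertices and the connection partner -/

section Conn

variable {v : ℕ} (G : SimpleGraph (Fin v)) (T : Set (Sym2 (Fin v))) [DecidablePred (· ∈ T)]

/-- The ordered adjacent pairs of the base graph (positions of link vertices). [folklore] -/
abbrev CFIDart : Type := {p : Fin v × Fin v // G.Adj p.1 p.2}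

/-- The TWIST BIT of the base edge `uw`: `[uw ∈ T]`. [cite: CaiFurerImmerman1992, §6] -/
def twist (u w : Fin v) : Bool := decide (s(u, w) ∈ T)

/-- **The connection partner** of the link `(u, w, c)`: the link `(w, u, c ⊕ [uw ∈ T])` of the
gadget of `w` it is joined to (`a(u,v)a(v,u)`, `b(u,v)b(v,u)` untwisted, `a(u,v)b(v,u)`,
`b(u,v)a(v,u)` twisted). [cite: ChenFlumLiu2025, §6 (p. 58)] -/
def conn (x : CFIDart G × Bool) : CFIDart G × Bool :=
  (⟨(x.1.1.2, x.1.1.1), x.1.2.symm⟩, xor x.2 (twist T x.1.1.1 x.1.1.2))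

variable {G T}

/-- The twist bit is symmetric. [folklore] -/
theorem twist_comm (u w : Fin v) : twist T u w = twist T w u := by
  unfold twist
  rw [Sym2.eq_swap]

/-- `conn` is an involution. [folklore] -/
@[simp] theorem conn_conn (x : CFIDart G × Bool) : conn G T (conn G T x) = x := by
  obtain ⟨⟨⟨u, w⟩, h⟩, c⟩ := x
  show ((⟨(u, w), _⟩, xor (xor c (twist T u w)) (twist T w u)) : CFIDart G × Bool) = _
  rw [twist_comm w u, Bool.xor_assoc, Bool.xor_self, Bool.xor_false]

/-- The base vertex of the connection partner is the other endpoint. [folklore] -/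
@[simp] theorem conn_fst (x : CFIDart G × Bool) : (conn G T x).1.1 = (x.1.1.2, x.1.1.1) := rfl

/-- A link is not its own connection partner. [folklore] -/
theorem conn_ne (x : CFIDart G × Bool) : conn G T x ≠ x := by
  intro h
  have := congrArg (fun y => y.1.1.1) h
  simp only [conn_fst] at this
  exact x.1.2.ne this.symm

/-- Equality of links in components. [folklore] -/
theorem link_eq_iff {u w u' w' : Fin v} {h : G.Adj u w} {h' : G.Adj u' w'} {c c' : Bool} :
    ((⟨(u, w), h⟩, c) : CFIDart G × Bool) = (⟨(u', w'), h'⟩, c') ↔ u = u' ∧ w = w' ∧ c = c' := by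
  constructor
  · intro heq
    have h1 : (u, w) = (u', w') := congrArg (fun y => y.1.1) heq
    obtain ⟨rfl, rfl⟩ := Prod.mk.inj h1
    exact ⟨rfl, rfl, congrArg Prod.snd heq⟩
  · rintro ⟨rfl, rfl, rfl⟩
    rfl

/-- The Boolean rendering of "`c = c'` iff not twisted". [folklore] -/
theorem bool_eq_iff_not_iff {c c' : Bool} {P : Prop} [Decidable P] :
    (c = c' ↔ ¬ P) ↔ c' = xor c (decide P) := by
  by_cases hP : P <;> cases c <;> cases c' <;> simp [hP]

end Conn

section Graph

variable {v : ℕ} {G : SimpleGraph (Fin v)} [DecidableRel G.Adj]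
  {T : Set (Sym2 (Fin v))} [DecidablePred (· ∈ T)]

variable (G) in
/-- The index type of the middle vertices: a base vertex and an even subset of its
neighbourhood. [cite: CaiFurerImmerman1992, §6] -/
abbrev CFIMidIdx : Type := Σ u : Fin v, {S : Finset (Fin v) // S ⊆ G.neighborFinset u ∧ Even S.card}

variable (G T) in
/-- Adjacency of `CFI(G, T)` is decidable (classically: the graph is a specification-level object;
this supplies `neighborFinset`/`degree`). [folklore] -/
noncomputable instance instDecidableRelCfiGraphAdj : DecidableRel (cfiGraph G T).Adj :=
  Classical.decRel _

/-- The LINK VERTEX `(u, w, c)` of `CFI(G, ·)` (typed constructor for `Sum.inr`; the vertex type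
`CFIVertex G` is a `def`, and keeping its name in the types keeps rewriting robust).
[cite: CaiFurerImmerman1992, §6] -/
def linkV (x : CFIDart G × Bool) : CFIVertex G := Sum.inr x

/-- The MIDDLE VERTEX `m(u, S)` of `CFI(G, ·)` (typed constructor for `Sum.inl`).
[cite: CaiFurerImmerman1992, §6] -/
def midV (x : CFIMidIdx G) : CFIVertex G := Sum.inl x

omit [DecidablePred (· ∈ T)] in
/-- Every vertex is a link or a middle vertex. [folklore] -/
theorem linkV_or_midV (y : CFIVertex G) : (∃ x, y = linkV x) ∨ ∃ x, y = midV x := by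
  rcases y with x | x
  · exact Or.inr ⟨x, rfl⟩
  · exact Or.inl ⟨x, rfl⟩

omit [DecidablePred (· ∈ T)] in
/-- `linkV` is injective. [folklore] -/
theorem linkV_inj {x y : CFIDart G × Bool} : linkV x = linkV y ↔ x = y :=
  Sum.inr_injective.eq_iff

omit [DecidablePred (· ∈ T)] in
/-- `midV` is injective. [folklore] -/
theorem midV_inj {x y : CFIMidIdx G} : midV x = midV y ↔ x = y :=
  Sum.inl_injective.eq_iff

omit [DecidablePred (· ∈ T)] in
/-- A middle vertex is not a link vertex. [folklore] -/
theorem midV_ne_linkV {x : CFIMidIdx G} {y : CFIDart G × Bool} : midV x ≠ linkV y := Sum.inl_ne_inr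

omit [DecidablePred (· ∈ T)] in
/-- A link vertex is not a middle vertex. [folklore] -/
theorem linkV_ne_midV {x : CFIMidIdx G} {y : CFIDart G × Bool} : linkV y ≠ midV x := Sum.inr_ne_inl

omit [DecidablePred (· ∈ T)] in
/-- Equality of link vertices in components. [folklore] -/
theorem linkV_eq_iff {u w u' w' : Fin v} {h : G.Adj u w} {h' : G.Adj u' w'} {c c' : Bool} :
    linkV (⟨(u, w), h⟩, c) = linkV (⟨(u', w'), h'⟩, c') ↔ u = u' ∧ w = w' ∧ c = c' :=
  linkV_inj.trans link_eq_iff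

omit [DecidablePred (· ∈ T)] in
/-- Equality of middle indices in components. [folklore] -/
theorem mid_eq_iff {u u' : Fin v} {S : {S : Finset (Fin v) // S ⊆ G.neighborFinset u ∧ Even S.card}}
    {S' : {S : Finset (Fin v) // S ⊆ G.neighborFinset u' ∧ Even S.card}} :
    ((⟨u, S⟩ : CFIMidIdx G) = ⟨u', S'⟩) ↔ u = u' ∧ S.1 = S'.1 := by
  constructor
  · intro heq
    obtain ⟨rfl, hS⟩ := Sigma.mk.inj_iff.mp heq
    exact ⟨rfl, by rw [eq_of_heq hS]⟩
  · rintro ⟨rfl, hS⟩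
    rw [Subtype.ext hS]

omit [DecidablePred (· ∈ T)] in
/-- Equality of middle vertices in components. [folklore] -/
theorem midV_eq_iff {u u' : Fin v} {S : {S : Finset (Fin v) // S ⊆ G.neighborFinset u ∧ Even S.card}}
    {S' : {S : Finset (Fin v) // S ⊆ G.neighborFinset u' ∧ Even S.card}} :
    midV ⟨u, S⟩ = midV ⟨u', S'⟩ ↔ u = u' ∧ S.1 = S'.1 :=
  midV_inj.trans mid_eq_iff

/-! ### Adjacency -/

/-- Middle vertices are pairwise non-adjacent. [cite: CaiFurerImmerman1992, §6] -/
theorem not_adj_midV_midV (x y : CFIMidIdx G) : ¬ (cfiGraph G T).Adj (midV x) (midV y) :=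
  cfiGraph_not_adj_inl_inl G T x y

/-- **Middle–link adjacency**: `m(u, S) ~ (u', w, c)` iff `u = u'` and `c = [w ∈ S]`.
[cite: ChenFlumLiu2025, §3 (3.1)] -/
theorem adj_midV_linkV (u : Fin v) (S : {S : Finset (Fin v) // S ⊆ G.neighborFinset u ∧ Even S.card})
    (p : CFIDart G) (c : Bool) :
    (cfiGraph G T).Adj (midV ⟨u, S⟩) (linkV (p, c)) ↔ u = p.1.1 ∧ (c = true ↔ p.1.2 ∈ S.1) :=
  cfiGraph_adj_inl_inr G T u S p c

/-- **Link–link adjacency**: a link is adjacent to exactly one link, its connection partner.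
[cite: ChenFlumLiu2025, §6 (p. 58)] -/
theorem adj_linkV_linkV (x y : CFIDart G × Bool) :
    (cfiGraph G T).Adj (linkV x) (linkV y) ↔ y = conn G T x := by
  obtain ⟨⟨⟨u, w⟩, hp⟩, c⟩ := x
  obtain ⟨⟨⟨w', u'⟩, hq⟩, c'⟩ := y
  have key : (cfiGraph G T).Adj (linkV (⟨(u, w), hp⟩, c)) (linkV (⟨(w', u'), hq⟩, c')) ↔
      w' = w ∧ u' = u ∧ (c = c' ↔ s(u, w) ∉ T) := by
    simp only [linkV, cfiGraph, SimpleGraph.fromRel_adj, cfiRel]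
    constructor
    · rintro ⟨-, h | h⟩
      · exact h
      · obtain ⟨rfl, rfl, h3⟩ := h
        exact ⟨rfl, rfl, by rw [eq_comm, Sym2.eq_swap]; exact h3⟩
    · rintro ⟨rfl, rfl, h3⟩
      refine ⟨fun heq => hp.ne (link_eq_iff.mp (Sum.inr_injective heq)).1, Or.inl ⟨rfl, rfl, h3⟩⟩
  rw [key]
  constructor
  · rintro ⟨rfl, rfl, h3⟩
    exact Prod.ext rfl (bool_eq_iff_not_iff.mp h3)
  · intro h
    have h1 : (w', u') = (w, u) := congrArg (fun y => y.1.1) h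
    have h2 : c' = xor c (twist T u w) := congrArg Prod.snd h
    obtain ⟨rfl, rfl⟩ := Prod.mk.inj h1
    exact ⟨rfl, rfl, bool_eq_iff_not_iff.mpr h2⟩

/-- **Adjacency of a middle vertex**: `m(u, S)` is adjacent exactly to the links `(u, w, [w ∈ S])`,
`w ∈ N(u)` ((3.1) of the source: `am` for `a ∈ m`, `a′m` for `a ∉ m`).
[cite: ChenFlumLiu2025, §3 (3.1)] -/
theorem adj_midV_iff (u : Fin v) (S : {S : Finset (Fin v) // S ⊆ G.neighborFinset u ∧ Even S.card})
    (y : CFIVertex G) :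
    (cfiGraph G T).Adj (midV ⟨u, S⟩) y ↔
      ∃ (w : Fin v) (h : G.Adj u w) (c : Bool), y = linkV (⟨(u, w), h⟩, c) ∧ (c = true ↔ w ∈ S.1) := by
  rcases linkV_or_midV y with ⟨⟨⟨⟨u', w⟩, h⟩, c⟩, rfl⟩ | ⟨⟨u', S'⟩, rfl⟩
  · rw [adj_midV_linkV]
    constructor
    · rintro ⟨rfl, hc⟩
      exact ⟨w, h, c, rfl, hc⟩
    · rintro ⟨w', h', c', heq, hc⟩
      have hh : u' = u ∧ w = w' ∧ c = c' := linkV_eq_iff.mp heq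
      obtain ⟨rfl, rfl, rfl⟩ := hh
      exact ⟨rfl, hc⟩
  · constructor
    · intro h
      exact absurd h (not_adj_midV_midV _ _)
    · rintro ⟨w, h, c, heq, -⟩
      exact absurd heq midV_ne_linkV

/-- **Adjacency of a link vertex**: `(u, w, c)` is adjacent exactly to the middle vertices
`m(u, S)` with `[w ∈ S] = c` and to its connection partner ((3.1), (3.3) and §6 of the source).
[cite: ChenFlumLiu2025, §3 (3.1), (3.3)] -/
theorem adj_linkV_iff (x : CFIDart G × Bool) (y : CFIVertex G) :
    (cfiGraph G T).Adj (linkV x) y ↔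
      (∃ S, y = midV ⟨x.1.1.1, S⟩ ∧ (x.2 = true ↔ x.1.1.2 ∈ S.1)) ∨ y = linkV (conn G T x) := by
  rcases linkV_or_midV y with ⟨y, rfl⟩ | ⟨⟨u', S'⟩, rfl⟩
  · rw [adj_linkV_linkV]
    constructor
    · intro h
      exact Or.inr (congrArg linkV h)
    · rintro (⟨S, heq, -⟩ | heq)
      · exact absurd heq linkV_ne_midV
      · exact linkV_inj.mp heq
  · rw [SimpleGraph.adj_comm, adj_midV_iff]
    constructor
    · rintro ⟨w, h, c, heq, hc⟩
      obtain ⟨⟨⟨u, w₀⟩, h₀⟩, c₀⟩ := x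
      have hh : u = u' ∧ w₀ = w ∧ c₀ = c := linkV_eq_iff.mp heq
      obtain ⟨rfl, rfl, rfl⟩ := hh
      exact Or.inl ⟨S', rfl, hc⟩
    · rintro (⟨S, heq, hc⟩ | heq)
      · obtain ⟨⟨⟨u, w₀⟩, h₀⟩, c₀⟩ := x
        have hh : u' = u ∧ S'.1 = S.1 := midV_eq_iff.mp heq
        obtain ⟨rfl, hS⟩ := hh
        obtain rfl : S' = S := Subtype.ext hS
        exact ⟨w₀, h₀, c₀, rfl, hc⟩
      · exact absurd heq midV_ne_linkV

/-- A link is adjacent to its connection partner. [cite: ChenFlumLiu2025, §6 (p. 58)] -/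
theorem adj_linkV_conn (x : CFIDart G × Bool) : (cfiGraph G T).Adj (linkV x) (linkV (conn G T x)) :=
  (adj_linkV_linkV x _).mpr rfl

/-- A middle vertex and a link with matching bit are adjacent. [cite: ChenFlumLiu2025, §3 (3.1)] -/
theorem adj_midV_linkV_of_iff {u w : Fin v} (h : G.Adj u w)
    (S : {S : Finset (Fin v) // S ⊆ G.neighborFinset u ∧ Even S.card}) (c : Bool) (hc : c = true ↔ w ∈ S.1) :
    (cfiGraph G T).Adj (midV ⟨u, S⟩) (linkV (⟨(u, w), h⟩, c)) :=
  (adj_midV_linkV u S ⟨(u, w), h⟩ c).mpr ⟨rfl, hc⟩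

/-- **Twins have no common middle neighbour** ((3.3) of the source: `xm ∈ E ⇔ x′m ∉ E`).
[cite: ChenFlumLiu2025, §3 (3.3)] -/
theorem not_adj_twin_of_adj {u : Fin v} {S : {S : Finset (Fin v) // S ⊆ G.neighborFinset u ∧ Even S.card}}
    {p : CFIDart G} {c : Bool} (h : (cfiGraph G T).Adj (midV ⟨u, S⟩) (linkV (p, c))) :
    ¬ (cfiGraph G T).Adj (midV ⟨u, S⟩) (linkV (p, !c)) := by
  rw [adj_midV_linkV] at h ⊢
  rintro ⟨-, h'⟩
  have := h.2
  cases c <;> simp_all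

/-! ### The base vertex; degrees -/

omit [DecidablePred (· ∈ T)] in
/-- The base vertex (gadget index) of a vertex of `CFI(G, T)`. [cite: CaiFurerImmerman1992, §6] -/
def base : CFIVertex G → Fin v
  | .inl x => x.1
  | .inr x => x.1.1.1

omit [DecidablePred (· ∈ T)] in
/-- The base of a middle vertex. [folklore] -/
@[simp] theorem base_midV (x : CFIMidIdx G) : base (midV x) = x.1 := rfl

omit [DecidablePred (· ∈ T)] in
/-- The base of a link vertex. [folklore] -/
@[simp] theorem base_linkV (x : CFIDart G × Bool) : base (linkV x) = x.1.1.1 := rfl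

/-- Two adjacent links have different bases. [folklore] -/
theorem base_conn_ne (x : CFIDart G × Bool) : base (linkV (conn G T x)) ≠ base (linkV x) := by
  simp only [base_linkV, conn_fst]
  exact x.1.2.ne.symm

/-- Adjacent vertices with the same base: a middle vertex and a link of one gadget, in either
order. [folklore] -/
theorem base_eq_of_adj_iff {x y : CFIVertex G} (h : (cfiGraph G T).Adj x y) :
    base x = base y ↔ (∃ m, x = midV m) ∨ ∃ m, y = midV m := by
  constructor
  · intro hb
    rcases linkV_or_midV x with ⟨x, rfl⟩ | ⟨m, rfl⟩
    · rcases (adj_linkV_iff x y).mp h with ⟨S, rfl, -⟩ | rfl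
      · exact Or.inr ⟨_, rfl⟩
      · exact absurd hb.symm (base_conn_ne x)
    · exact Or.inl ⟨m, rfl⟩
  · rintro (⟨⟨u, S⟩, rfl⟩ | ⟨⟨u, S⟩, rfl⟩)
    · obtain ⟨w, hw, c, rfl, -⟩ := (adj_midV_iff u S y).mp h
      rfl
    · obtain ⟨w, hw, c, rfl, -⟩ := (adj_midV_iff u S x).mp h.symm
      rfl

/-- **A middle vertex has the degree of its base vertex** (one link per neighbour).
[cite: ChenFlumLiu2025, §3 (3.1)] -/
theorem degree_midV (u : Fin v) (S : {S : Finset (Fin v) // S ⊆ G.neighborFinset u ∧ Even S.card}) :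
    (cfiGraph G T).degree (midV ⟨u, S⟩) = G.degree u := by
  rw [← SimpleGraph.card_neighborFinset_eq_degree, ← SimpleGraph.card_neighborFinset_eq_degree]
  symm
  refine Finset.card_bij
    (fun w hw => linkV (⟨(u, w), (G.mem_neighborFinset u w).mp hw⟩, decide (w ∈ S.1))) ?_ ?_ ?_
  · intro w hw
    rw [SimpleGraph.mem_neighborFinset]
    exact adj_midV_linkV_of_iff _ S _ decide_eq_true_iff
  · intro w₁ hw₁ w₂ hw₂ heq
    exact (linkV_eq_iff.mp heq).2.1
  · intro y hy
    rw [SimpleGraph.mem_neighborFinset, adj_midV_iff] at hy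
    obtain ⟨w, h, c, rfl, hc⟩ := hy
    refine ⟨w, (G.mem_neighborFinset u w).mpr h, linkV_eq_iff.mpr ⟨rfl, rfl, ?_⟩⟩
    cases c
    · simpa using hc
    · simpa using hc

omit [DecidablePred (· ∈ T)] in
/-- A base vertex of degree at least three has two further neighbours besides a given one.
[folklore] -/
theorem exists_two_other_neighbors {u : Fin v} (w : Fin v) (h3 : 3 ≤ G.degree u) :
    ∃ w' w'', G.Adj u w' ∧ G.Adj u w'' ∧ w' ≠ w ∧ w'' ≠ w ∧ w' ≠ w'' := by
  have hcard : 1 < ((G.neighborFinset u).erase w).card := by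
    have := Finset.pred_card_le_card_erase (s := G.neighborFinset u) (a := w)
    rw [SimpleGraph.card_neighborFinset_eq_degree] at this
    omega
  obtain ⟨a, ha, b, hb, hab⟩ := Finset.one_lt_card.mp hcard
  rw [Finset.mem_erase, SimpleGraph.mem_neighborFinset] at ha hb
  exact ⟨a, b, ha.2, hb.2, ha.1, hb.1, hab⟩

/-- The even pair `{a, b} ⊆ N(u)` as a middle index. [folklore] -/
def pairMid {u a b : Fin v} (ha : G.Adj u a) (hb : G.Adj u b) (hab : a ≠ b) :
    {S : Finset (Fin v) // S ⊆ G.neighborFinset u ∧ Even S.card} :=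
  ⟨{a, b}, by
    refine ⟨?_, ?_⟩
    · intro x hx
      rw [Finset.mem_insert, Finset.mem_singleton] at hx
      rw [SimpleGraph.mem_neighborFinset]
      rcases hx with rfl | rfl
      · exact ha
      · exact hb
    · rw [Finset.card_pair hab]
      exact even_two⟩

omit [DecidablePred (· ∈ T)] in
/-- The underlying set of `pairMid`. [folklore] -/
@[simp] theorem pairMid_val {u a b : Fin v} (ha : G.Adj u a) (hb : G.Adj u b) (hab : a ≠ b) :
    (pairMid ha hb hab).1 = {a, b} := rfl

variable (G) in
/-- The empty middle index `m(u, ∅)`. [folklore] -/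
def emptyMid (u : Fin v) : {S : Finset (Fin v) // S ⊆ G.neighborFinset u ∧ Even S.card} :=
  ⟨∅, Finset.empty_subset _, by simp⟩

omit [DecidablePred (· ∈ T)] in
/-- The underlying set of `emptyMid`. [folklore] -/
@[simp] theorem emptyMid_val (u : Fin v) : (emptyMid G u).1 = ∅ := rfl

omit [DecidablePred (· ∈ T)] in
/-- Over a base vertex of degree `≥ 3`, for each bit there are two distinct even subsets with that
bit at a given position. [folklore] -/
theorem exists_two_mids {u w : Fin v} (hw : G.Adj u w) (h3 : 3 ≤ G.degree u) (c : Bool) :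
    ∃ S₁ S₂ : {S : Finset (Fin v) // S ⊆ G.neighborFinset u ∧ Even S.card},
      S₁ ≠ S₂ ∧ (c = true ↔ w ∈ S₁.1) ∧ (c = true ↔ w ∈ S₂.1) := by
  obtain ⟨w', w'', hw', hw'', hne', hne'', hne⟩ := exists_two_other_neighbors w h3
  cases c
  · refine ⟨emptyMid G u, pairMid hw' hw'' hne, ?_, by simp, ?_⟩
    · intro heq
      have h1 : (∅ : Finset (Fin v)) = {w', w''} := congrArg Subtype.val heq
      have : w' ∈ (∅ : Finset (Fin v)) := by rw [h1]; exact Finset.mem_insert_self _ _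
      exact absurd this (Finset.notMem_empty _)
    · simp only [pairMid_val, Finset.mem_insert, Finset.mem_singleton, Bool.false_eq_true, false_iff,
        not_or]
      exact ⟨hne'.symm, hne''.symm⟩
  · refine ⟨pairMid hw hw' hne'.symm, pairMid hw hw'' hne''.symm, ?_, by simp, by simp⟩
    intro heq
    have h1 : ({w, w'} : Finset (Fin v)) = {w, w''} := congrArg Subtype.val heq
    have hmem : w' ∈ ({w, w''} : Finset (Fin v)) := by rw [← h1]; simp
    rw [Finset.mem_insert, Finset.mem_singleton] at hmem
    rcases hmem with h1 | h2
    · exact hne' h1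
    · exact hne h2

/-- **Links over base vertices of degree `≥ 3` have degree `≥ 3`**: the connection partner and two
middle vertices. [cite: ChenFlumLiu2025, §8 (with (6.2))] -/
theorem three_le_degree_linkV {x : CFIDart G × Bool} (h3 : 3 ≤ G.degree x.1.1.1) :
    3 ≤ (cfiGraph G T).degree (linkV x) := by
  obtain ⟨⟨⟨u, w⟩, h⟩, c⟩ := x
  obtain ⟨S₁, S₂, hS, hc₁, hc₂⟩ := exists_two_mids h h3 c
  rw [← SimpleGraph.card_neighborFinset_eq_degree]
  refine Finset.two_lt_card.mpr ⟨linkV (conn G T (⟨(u, w), h⟩, c)), ?_, midV ⟨u, S₁⟩, ?_, midV ⟨u, S₂⟩, ?_,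
    linkV_ne_midV, linkV_ne_midV, fun heq => hS ?_⟩
  · rw [SimpleGraph.mem_neighborFinset]; exact adj_linkV_conn _
  · rw [SimpleGraph.mem_neighborFinset]; exact (adj_midV_linkV_of_iff h S₁ c hc₁).symm
  · rw [SimpleGraph.mem_neighborFinset]; exact (adj_midV_linkV_of_iff h S₂ c hc₂).symm
  · exact Subtype.ext (midV_eq_iff.mp heq).2

/-- **Vertices over base vertices of degree `≥ 3` have degree `≥ 3`.** [folklore] -/
theorem three_le_degree_of_base {x : CFIVertex G} (h3 : 3 ≤ G.degree (base x)) : 3 ≤ (cfiGraph G T).degree x := by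
  rcases linkV_or_midV x with ⟨x, rfl⟩ | ⟨⟨u, S⟩, rfl⟩
  · exact three_le_degree_linkV h3
  · rw [degree_midV]; exact h3

/-! ### Gadgets over base vertices of degree one and two -/

omit [DecidablePred (· ∈ T)] in
/-- Over a base vertex with `N(u) = {w}` the only even subset is `∅`. [cite: ChenFlumLiu2025, §3 (Fig. 3.1)] -/
theorem mid_val_eq_empty_of_singleton {u w : Fin v} (hN : G.neighborFinset u = {w})
    (S : {S : Finset (Fin v) // S ⊆ G.neighborFinset u ∧ Even S.card}) : S.1 = ∅ := by
  obtain ⟨S, hS, he⟩ := S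
  rw [hN] at hS
  rcases Finset.subset_singleton_iff.mp hS with h | h
  · exact h
  · rw [h, Finset.card_singleton] at he
    exact absurd he (by decide)

omit [DecidablePred (· ∈ T)] in
/-- Over a base vertex with `N(u) = {w, w₂}` the even subsets are `∅` and `{w, w₂}`.
[cite: ChenFlumLiu2025, §3 (Fig. 3.1)] -/
theorem mid_val_eq_of_pair {u w w₂ : Fin v} (hN : G.neighborFinset u = {w, w₂}) (hne : w ≠ w₂)
    (S : {S : Finset (Fin v) // S ⊆ G.neighborFinset u ∧ Even S.card}) : S.1 = ∅ ∨ S.1 = {w, w₂} := by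
  obtain ⟨S, hS, he⟩ := S
  rw [hN] at hS
  have hcard : S.card ≤ 2 := (Finset.card_le_card hS).trans Finset.card_le_two
  have h02 : S.card = 0 ∨ S.card = 2 := by
    obtain ⟨r, hr⟩ := he
    omega
  rcases h02 with h0 | h2
  · exact Or.inl (Finset.card_eq_zero.mp h0)
  · exact Or.inr (Finset.eq_of_subset_of_card_le hS (by rw [Finset.card_pair hne, h2]))

/-- The middle index over a degree-two base vertex with prescribed bit: `{w, w₂}` or `∅`.
[folklore] -/
def lowMid {u w w₂ : Fin v} (hw : G.Adj u w) (hw₂ : G.Adj u w₂) (hne : w ≠ w₂) (c : Bool) :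
    {S : Finset (Fin v) // S ⊆ G.neighborFinset u ∧ Even S.card} :=
  if c then pairMid hw hw₂ hne else emptyMid G u

omit [DecidablePred (· ∈ T)] in
/-- Membership of the two positions in `lowMid`. [folklore] -/
theorem mem_lowMid_iff {u w w₂ : Fin v} (hw : G.Adj u w) (hw₂ : G.Adj u w₂) (hne : w ≠ w₂) (c : Bool) :
    (c = true ↔ w ∈ (lowMid hw hw₂ hne c).1) ∧ (c = true ↔ w₂ ∈ (lowMid hw hw₂ hne c).1) := by
  unfold lowMid
  cases c <;> simp

omit [DecidablePred (· ∈ T)] in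
/-- Over a degree-two base vertex the middle index is determined by its bit at either position.
[folklore] -/
theorem mid_eq_lowMid {u w w₂ : Fin v} (hN : G.neighborFinset u = {w, w₂}) (hw : G.Adj u w)
    (hw₂ : G.Adj u w₂) (hne : w ≠ w₂) (S : {S : Finset (Fin v) // S ⊆ G.neighborFinset u ∧ Even S.card})
    (c : Bool) (hc : (c = true ↔ w ∈ S.1) ∨ (c = true ↔ w₂ ∈ S.1)) : S = lowMid hw hw₂ hne c := by
  apply Subtype.ext
  unfold lowMid
  rcases mid_val_eq_of_pair hN hne S with h | h
  · have hc' : c = false := by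
      rcases hc with hc | hc <;> · rw [h] at hc; simpa using hc
    subst hc'
    simpa using h
  · have hc' : c = true := by
      rcases hc with hc | hc <;> · rw [h] at hc; simpa using hc
    subst hc'
    simpa using h

/-- **The neighbourhood of a link over a degree-two base vertex**: its connection partner and
one middle vertex. [cite: ChenFlumLiu2025, §3 (Fig. 3.1), §8] -/
theorem neighborFinset_linkV_of_pair {u w w₂ : Fin v} (hN : G.neighborFinset u = {w, w₂}) (hw : G.Adj u w)
    (hw₂ : G.Adj u w₂) (hne : w ≠ w₂) (c : Bool) :
    (cfiGraph G T).neighborFinset (linkV (⟨(u, w), hw⟩, c)) =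
      {linkV (conn G T (⟨(u, w), hw⟩, c)), midV ⟨u, lowMid hw hw₂ hne c⟩} := by
  ext y
  rw [SimpleGraph.mem_neighborFinset, adj_linkV_iff, Finset.mem_insert, Finset.mem_singleton]
  constructor
  · rintro (⟨S, rfl, hc⟩ | rfl)
    · right
      rw [mid_eq_lowMid hN hw hw₂ hne S c (Or.inl hc)]
    · exact Or.inl rfl
  · rintro (rfl | rfl)
    · exact Or.inr rfl
    · exact Or.inl ⟨_, rfl, (mem_lowMid_iff hw hw₂ hne c).1⟩

/-- The same for the link at the other position. [cite: ChenFlumLiu2025, §3 (Fig. 3.1), §8] -/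
theorem neighborFinset_linkV_of_pair' {u w w₂ : Fin v} (hN : G.neighborFinset u = {w, w₂}) (hw : G.Adj u w)
    (hw₂ : G.Adj u w₂) (hne : w ≠ w₂) (c : Bool) :
    (cfiGraph G T).neighborFinset (linkV (⟨(u, w₂), hw₂⟩, c)) =
      {linkV (conn G T (⟨(u, w₂), hw₂⟩, c)), midV ⟨u, lowMid hw hw₂ hne c⟩} := by
  ext y
  rw [SimpleGraph.mem_neighborFinset, adj_linkV_iff, Finset.mem_insert, Finset.mem_singleton]
  constructor
  · rintro (⟨S, rfl, hc⟩ | rfl)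
    · right
      rw [mid_eq_lowMid hN hw hw₂ hne S c (Or.inr hc)]
    · exact Or.inl rfl
  · rintro (rfl | rfl)
    · exact Or.inr rfl
    · exact Or.inl ⟨_, rfl, (mem_lowMid_iff hw hw₂ hne c).2⟩

/-- **The neighbourhood of a middle vertex over a degree-two base vertex**: its two links.
[cite: ChenFlumLiu2025, §3 (Fig. 3.1)] -/
theorem neighborFinset_midV_of_pair {u w w₂ : Fin v} (hN : G.neighborFinset u = {w, w₂}) (hw : G.Adj u w)
    (hw₂ : G.Adj u w₂) (S : {S : Finset (Fin v) // S ⊆ G.neighborFinset u ∧ Even S.card}) :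
    (cfiGraph G T).neighborFinset (midV ⟨u, S⟩) =
      {linkV (⟨(u, w), hw⟩, decide (w ∈ S.1)), linkV (⟨(u, w₂), hw₂⟩, decide (w₂ ∈ S.1))} := by
  ext y
  rw [SimpleGraph.mem_neighborFinset, adj_midV_iff, Finset.mem_insert, Finset.mem_singleton]
  constructor
  · rintro ⟨w', h', c', rfl, hc⟩
    have hw' : w' ∈ G.neighborFinset u := (G.mem_neighborFinset u w').mpr h'
    rw [hN, Finset.mem_insert, Finset.mem_singleton] at hw'
    rcases hw' with rfl | rfl
    · left
      exact linkV_eq_iff.mpr ⟨rfl, rfl, by cases c' <;> simp_all⟩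
    · right
      exact linkV_eq_iff.mpr ⟨rfl, rfl, by cases c' <;> simp_all⟩
  · rintro (rfl | rfl)
    · exact ⟨w, hw, _, rfl, decide_eq_true_iff⟩
    · exact ⟨w₂, hw₂, _, rfl, decide_eq_true_iff⟩

/-- **The neighbourhood of the `a`-link of a leaf gadget**: only its connection partner (a dead
end). [cite: ChenFlumLiu2025, §3 (Fig. 3.1), §7 (proof of Lemma 7.17, case `deg(v) = 1`)] -/
theorem neighborFinset_linkV_true_of_singleton {u w : Fin v} (hN : G.neighborFinset u = {w}) (hw : G.Adj u w) :
    (cfiGraph G T).neighborFinset (linkV (⟨(u, w), hw⟩, true)) = {linkV (conn G T (⟨(u, w), hw⟩, true))} := by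
  ext y
  rw [SimpleGraph.mem_neighborFinset, adj_linkV_iff, Finset.mem_singleton]
  constructor
  · rintro (⟨S, rfl, hc⟩ | rfl)
    · have := mid_val_eq_empty_of_singleton hN S
      simp only [true_iff] at hc
      rw [this] at hc
      exact absurd hc (Finset.notMem_empty _)
    · rfl
  · rintro rfl
    exact Or.inr rfl

/-- **The neighbourhood of the `b`-link of a leaf gadget**: its connection partner and `m(u, ∅)`.
[cite: ChenFlumLiu2025, §3 (Fig. 3.1), §7 (proof of Lemma 7.17, case `deg(v) = 1`)] -/
theorem neighborFinset_linkV_false_of_singleton {u w : Fin v} (hN : G.neighborFinset u = {w}) (hw : G.Adj u w) :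
    (cfiGraph G T).neighborFinset (linkV (⟨(u, w), hw⟩, false)) =
      {linkV (conn G T (⟨(u, w), hw⟩, false)), midV ⟨u, emptyMid G u⟩} := by
  ext y
  rw [SimpleGraph.mem_neighborFinset, adj_linkV_iff, Finset.mem_insert, Finset.mem_singleton]
  constructor
  · rintro (⟨S, rfl, hc⟩ | rfl)
    · right
      have := mid_val_eq_empty_of_singleton hN S
      rw [show S = emptyMid G u from Subtype.ext this]
    · exact Or.inl rfl
  · rintro (rfl | rfl)
    · exact Or.inr rfl
    · exact Or.inl ⟨_, rfl, by simp⟩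

/-- **The neighbourhood of the middle vertex of a leaf gadget**: only its `b`-link (a dead end).
[cite: ChenFlumLiu2025, §3 (Fig. 3.1)] -/
theorem neighborFinset_midV_of_singleton {u w : Fin v} (hN : G.neighborFinset u = {w}) (hw : G.Adj u w)
    (S : {S : Finset (Fin v) // S ⊆ G.neighborFinset u ∧ Even S.card}) :
    (cfiGraph G T).neighborFinset (midV ⟨u, S⟩) = {linkV (⟨(u, w), hw⟩, false)} := by
  have hS := mid_val_eq_empty_of_singleton hN S
  ext y
  rw [SimpleGraph.mem_neighborFinset, adj_midV_iff, Finset.mem_singleton]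
  constructor
  · rintro ⟨w', h', c', rfl, hc⟩
    have hw' : w' ∈ G.neighborFinset u := (G.mem_neighborFinset u w').mpr h'
    rw [hN, Finset.mem_singleton] at hw'
    subst hw'
    rw [hS] at hc
    exact linkV_eq_iff.mpr ⟨rfl, rfl, by cases c' <;> simp_all⟩
  · rintro rfl
    exact ⟨w, hw, false, rfl, by rw [hS]; simp⟩

omit [DecidablePred (· ∈ T)] in
/-- The neighbourhood of a base vertex of degree one, named. [folklore] -/
theorem neighborFinset_eq_singleton_of_degree {u w : Fin v} (h1 : G.degree u = 1) (hw : G.Adj u w) :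
    G.neighborFinset u = {w} := by
  rw [← SimpleGraph.card_neighborFinset_eq_degree, Finset.card_eq_one] at h1
  obtain ⟨w₀, hN⟩ := h1
  have : w ∈ G.neighborFinset u := (G.mem_neighborFinset u w).mpr hw
  rw [hN, Finset.mem_singleton] at this
  rw [hN, this]

omit [DecidablePred (· ∈ T)] in
/-- The neighbourhood of a base vertex of degree two, named from one neighbour. [folklore] -/
theorem neighborFinset_eq_pair_of_degree {u w : Fin v} (h2 : G.degree u = 2) (hw : G.Adj u w) :
    ∃ w₂, G.Adj u w₂ ∧ w ≠ w₂ ∧ G.neighborFinset u = {w, w₂} := by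
  rw [← SimpleGraph.card_neighborFinset_eq_degree, Finset.card_eq_two] at h2
  obtain ⟨a, b, hab, hN⟩ := h2
  have hw' : w ∈ G.neighborFinset u := (G.mem_neighborFinset u w).mpr hw
  have ha : G.Adj u a := (G.mem_neighborFinset u a).mp (by rw [hN]; simp)
  have hb : G.Adj u b := (G.mem_neighborFinset u b).mp (by rw [hN]; simp)
  rw [hN, Finset.mem_insert, Finset.mem_singleton] at hw'
  rcases hw' with rfl | rfl
  · exact ⟨b, hb, hab, hN⟩
  · exact ⟨a, ha, hab.symm, by rw [hN, Finset.pair_comm]⟩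

/-- **Vertices over base vertices of degree `≤ 2` have degree `≤ 2`.** [folklore] -/
theorem degree_le_two_of_base {x : CFIVertex G} (h2 : G.degree (base x) ≤ 2) : (cfiGraph G T).degree x ≤ 2 := by
  rcases linkV_or_midV x with ⟨⟨⟨⟨u, w⟩, hw⟩, c⟩, rfl⟩ | ⟨⟨u, S⟩, rfl⟩
  · replace h2 : G.degree u ≤ 2 := h2
    rw [← SimpleGraph.card_neighborFinset_eq_degree]
    have hpos : 0 < G.degree u := (G.degree_pos_iff_exists_adj u).mpr ⟨w, hw⟩
    rcases (show G.degree u = 1 ∨ G.degree u = 2 by omega) with h1 | h2'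
    · have hN := neighborFinset_eq_singleton_of_degree h1 hw
      cases c
      · rw [neighborFinset_linkV_false_of_singleton hN]; exact Finset.card_le_two
      · rw [neighborFinset_linkV_true_of_singleton hN, Finset.card_singleton]; omega
    · obtain ⟨w₂, hw₂, hne, hN⟩ := neighborFinset_eq_pair_of_degree h2' hw
      rw [neighborFinset_linkV_of_pair hN hw hw₂ hne]; exact Finset.card_le_two
  · rw [degree_midV]; exact h2

/-- In particular, **a vertex has degree `≥ 3` iff it lies over a base vertex of degree `≥ 3`.**
[cite: ChenFlumLiu2025, §8 (first paragraph of the proof of Thm. 8.1)] -/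
theorem three_le_degree_iff (x : CFIVertex G) : 3 ≤ (cfiGraph G T).degree x ↔ 3 ≤ G.degree (base x) := by
  constructor
  · intro h
    by_contra hlt
    have := degree_le_two_of_base (T := T) (x := x) (by omega)
    omega
  · exact three_le_degree_of_base

/-! ### Six-cycles: gadget edges over base vertices of degree `≥ 3` lie on six-cycles -/

/-- The expansion of `List.Nodup` for six entries. [folklore] -/
theorem nodup_six_iff {V : Type*} (a b c d e f : V) :
    [a, b, c, d, e, f].Nodup ↔
      (a ≠ b ∧ a ≠ c ∧ a ≠ d ∧ a ≠ e ∧ a ≠ f) ∧ (b ≠ c ∧ b ≠ d ∧ b ≠ e ∧ b ≠ f) ∧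
        (c ≠ d ∧ c ≠ e ∧ c ≠ f) ∧ (d ≠ e ∧ d ≠ f) ∧ e ≠ f := by
  simp only [List.nodup_cons, List.mem_cons, List.not_mem_nil, or_false, not_or, List.nodup_nil,
    and_true, not_false_eq_true, ne_eq]

/-- **Every gadget edge over a base vertex of degree `≥ 3` lies on a six-cycle of its gadget**
(for `d = 3` the gadget is a subdivided `K₄`; in general use two further positions `w', w''`
and the middle vertices `S △ {w', w''}`, `S △ {w, w'}`). Cf. Lemma 3.1 of the source ("for
`d ≥ 3`, every two vertices in `Y(d)` are on at least one cycle of length at most 8").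
[cite: ChenFlumLiu2025, Lemma 3.1] -/
theorem sixCycleThrough_midV_linkV {u : Fin v} (h3 : 3 ≤ G.degree u)
    (S : {S : Finset (Fin v) // S ⊆ G.neighborFinset u ∧ Even S.card}) (p : CFIDart G) (c : Bool)
    (hadj : (cfiGraph G T).Adj (midV ⟨u, S⟩) (linkV (p, c))) :
    SixCycleThrough (cfiGraph G T) (midV ⟨u, S⟩) (linkV (p, c)) := by
  obtain ⟨⟨u', w⟩, hp⟩ := p
  obtain ⟨hu, hc⟩ := (adj_midV_linkV u S _ c).mp hadj
  dsimp only at hu hc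
  subst hu
  obtain ⟨w', w'', hw', hw'', hne', hne'', hne⟩ := exists_two_other_neighbors w h3
  have hwN : w ∈ G.neighborFinset u := (G.mem_neighborFinset u w).mpr hp
  have hw'N : w' ∈ G.neighborFinset u := (G.mem_neighborFinset u w').mpr hw'
  have hw''N : w'' ∈ G.neighborFinset u := (G.mem_neighborFinset u w'').mpr hw''
  let S₂ : {S : Finset (Fin v) // S ⊆ G.neighborFinset u ∧ Even S.card} :=
    ⟨toggle (toggle S.1 w') w'', toggle_subset (toggle_subset S.2.1 hw'N) hw''N,
      even_card_toggle_toggle.mpr S.2.2⟩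
  let S₃ : {S : Finset (Fin v) // S ⊆ G.neighborFinset u ∧ Even S.card} :=
    ⟨toggle (toggle S.1 w) w', toggle_subset (toggle_subset S.2.1 hwN) hw'N,
      even_card_toggle_toggle.mpr S.2.2⟩
  -- membership bookkeeping
  have m2w : w ∈ S₂.1 ↔ w ∈ S.1 :=
    (mem_toggle_of_ne hne''.symm).trans (mem_toggle_of_ne hne'.symm)
  have m2w' : w' ∈ S₂.1 ↔ w' ∉ S.1 := (mem_toggle_of_ne hne).trans mem_toggle_self
  have m3w : w ∈ S₃.1 ↔ w ∉ S.1 := (mem_toggle_of_ne hne'.symm).trans mem_toggle_self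
  have m3w' : w' ∈ S₃.1 ↔ w' ∉ S.1 := by
    show w' ∈ toggle (toggle S.1 w) w' ↔ w' ∉ S.1
    rw [mem_toggle_self, mem_toggle_of_ne hne']
  have m3w'' : w'' ∈ S₃.1 ↔ w'' ∈ S.1 := (mem_toggle_of_ne hne.symm).trans (mem_toggle_of_ne hne'')
  -- the cycle `m(S), (w,c), m(S₂), (w', c₃), m(S₃), (w'', c₅)`
  refine ⟨midV ⟨u, S₂⟩, linkV (⟨(u, w'), hw'⟩, decide (w' ∉ S.1)), midV ⟨u, S₃⟩,
    linkV (⟨(u, w''), hw''⟩, decide (w'' ∈ S.1)), ?_, ?_, ?_, ?_, ?_, ?_⟩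
  · exact (adj_midV_linkV_of_iff hp S₂ c (hc.trans m2w.symm)).symm
  · exact adj_midV_linkV_of_iff hw' S₂ _ (decide_eq_true_iff.trans m2w'.symm)
  · exact (adj_midV_linkV_of_iff hw' S₃ _ (decide_eq_true_iff.trans m3w'.symm)).symm
  · exact adj_midV_linkV_of_iff hw'' S₃ _ (decide_eq_true_iff.trans m3w''.symm)
  · exact (adj_midV_linkV_of_iff hw'' S _ decide_eq_true_iff).symm
  · rw [nodup_six_iff]
    refine ⟨⟨midV_ne_linkV, fun h => ?_, midV_ne_linkV, fun h => ?_, midV_ne_linkV⟩,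
      ⟨linkV_ne_midV, fun h => hne'.symm (linkV_eq_iff.mp h).2.1, linkV_ne_midV,
        fun h => hne''.symm (linkV_eq_iff.mp h).2.1⟩,
      ⟨midV_ne_linkV, fun h => ?_, midV_ne_linkV⟩, ⟨linkV_ne_midV, fun h => hne (linkV_eq_iff.mp h).2.1⟩,
      midV_ne_linkV⟩
    · -- `S = S₂` contradicts the bit at `w'`
      have hS : S.1 = S₂.1 := (midV_eq_iff.mp h).2
      have : w' ∈ S.1 ↔ w' ∉ S.1 := by
        conv_lhs => rw [hS]
        exact m2w'
      exact iff_not_self this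
    · -- `S = S₃` contradicts the bit at `w`
      have hS : S.1 = S₃.1 := (midV_eq_iff.mp h).2
      have : w ∈ S.1 ↔ w ∉ S.1 := by
        conv_lhs => rw [hS]
        exact m3w
      exact iff_not_self this
    · -- `S₂ = S₃` contradicts the bit at `w`
      have hS : S₂.1 = S₃.1 := (midV_eq_iff.mp h).2
      have h2 : w ∈ S₂.1 ↔ w ∉ S.1 := by
        rw [hS]
        exact m3w
      exact iff_not_self (m2w.symm.trans h2)

/-- Symmetric form: the gadget edge read from the link. [cite: ChenFlumLiu2025, Lemma 3.1] -/
theorem sixCycleThrough_linkV_midV {u : Fin v} (h3 : 3 ≤ G.degree u)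
    (S : {S : Finset (Fin v) // S ⊆ G.neighborFinset u ∧ Even S.card}) (p : CFIDart G) (c : Bool)
    (hadj : (cfiGraph G T).Adj (linkV (p, c)) (midV ⟨u, S⟩)) :
    SixCycleThrough (cfiGraph G T) (linkV (p, c)) (midV ⟨u, S⟩) :=
  (sixCycleThrough_midV_linkV h3 S p c hadj.symm).symm

/-! ### Six-cycles: connection edges and low gadget edges lie on none -/

/-- **No connection edge lies on a six-cycle** (a six-cycle through `x c(x)` would have to return
through the twin connection `x' c(x)'` and close up through a common middle neighbour of the
twins `x, x'`, excluded by (3.3)). Cf. Lemma 7.12 of the source (short cycles stay in a gadget).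
[cite: ChenFlumLiu2025, Lemma 7.12 (with (3.3))] -/
theorem not_sixCycleThrough_conn (x : CFIDart G × Bool) :
    ¬ SixCycleThrough (cfiGraph G T) (linkV x) (linkV (conn G T x)) := by
  obtain ⟨⟨⟨u, w⟩, hp⟩, c⟩ := x
  rintro ⟨v₂, v₃, v₄, v₅, h₁, h₂, h₃, h₄, h₅, hnd⟩
  rw [nodup_six_iff] at hnd
  obtain ⟨⟨-, hx2, -, -, -⟩, ⟨-, hy3, -, hy5⟩, -, -, -⟩ := hnd
  -- `v₅` is a middle vertex of `u`
  rcases (adj_linkV_iff _ _).mp h₅.symm with ⟨S₅, rfl, hc5⟩ | h5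
  swap
  · exact hy5 h5.symm
  -- `v₂` is a middle vertex of `w`
  rcases (adj_linkV_iff _ _).mp h₁ with ⟨S₂, rfl, hc2⟩ | h1
  swap
  · rw [conn_conn] at h1
    exact hx2 h1.symm
  -- `v₃` is a link of `w`, `v₄` a link of `u`
  obtain ⟨w₃, h₃', c₃, rfl, hc3⟩ := (adj_midV_iff _ _ _).mp h₂
  obtain ⟨w₄, h₄', c₄, rfl, hc4⟩ := (adj_midV_iff _ _ _).mp h₄.symm
  -- `v₃ ~ v₄`: `v₄ = conn v₃`, so `w₃ = u`, `w₄ = w`, `c₄ = c₃ ⊕ t`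
  have h34 := (adj_linkV_linkV _ _).mp h₃
  have e1 : (u, w₄) = (w₃, w) := congrArg (fun y => y.1.1) h34
  obtain ⟨e1a, e1b⟩ := Prod.mk.inj e1
  subst w₃
  subst w₄
  have e2 : c₄ = xor c₃ (twist T w u) := congrArg Prod.snd h34
  -- `v₃ ≠ conn x` forces `c₃ = !(c ⊕ t)`
  have hc3' : c₃ ≠ xor c (twist T u w) := fun h => hy3 (linkV_eq_iff.mpr ⟨rfl, rfl, h.symm⟩)
  -- hence `c₄ = !c`: the middle vertex `v₅` is adjacent to both twins `(u, w, c)`, `(u, w, !c)`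
  have key : ∀ a b t : Bool, b ≠ xor a t → xor b t = !a := by decide
  have hc4' : c₄ = !c := by
    rw [e2, twist_comm]
    exact key c c₃ _ hc3'
  subst hc4'
  have hc5' : c = true ↔ w ∈ S₅.1 := hc5
  have hc4'' : (!c) = true ↔ w ∈ S₅.1 := hc4
  cases c <;> simp_all

/-- Symmetric form. [cite: ChenFlumLiu2025, Lemma 7.12 (with (3.3))] -/
theorem not_sixCycleThrough_conn' (x : CFIDart G × Bool) :
    ¬ SixCycleThrough (cfiGraph G T) (linkV (conn G T x)) (linkV x) := fun h =>
  not_sixCycleThrough_conn x h.symm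

/-- **No gadget edge over a base vertex of degree `≤ 2` lies on a six-cycle** (`Y(1)` and `Y(2)`
are acyclic, Lemma 3.1, and a six-cycle cannot leave the gadget and return).
[cite: ChenFlumLiu2025, Lemma 3.1 and Lemma 7.12] -/
theorem not_sixCycleThrough_midV_linkV_of_degree_le_two {u : Fin v} (hd : G.degree u ≤ 2)
    (S : {S : Finset (Fin v) // S ⊆ G.neighborFinset u ∧ Even S.card}) (p : CFIDart G) (c : Bool)
    (hadj : (cfiGraph G T).Adj (midV ⟨u, S⟩) (linkV (p, c))) :
    ¬ SixCycleThrough (cfiGraph G T) (midV ⟨u, S⟩) (linkV (p, c)) := by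
  obtain ⟨⟨u', w⟩, hp⟩ := p
  obtain ⟨hu, hc⟩ := (adj_midV_linkV u S _ c).mp hadj
  dsimp only at hu hc
  subst hu
  rintro ⟨v₂, v₃, v₄, v₅, h₁, h₂, h₃, h₄, h₅, hnd⟩
  rw [nodup_six_iff] at hnd
  obtain ⟨⟨-, hx2, -, -, -⟩, ⟨-, hy3, -, hy5⟩, -, -, -⟩ := hnd
  -- `v₅` is a link `(u, w₅, c₅)` with `w₅ ≠ w`, so `N(u) = {w, w₅}`
  obtain ⟨w₅, h₅', c₅, rfl, hc5⟩ := (adj_midV_iff _ _ _).mp h₅.symm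
  have hw5 : w₅ ≠ w := by
    rintro rfl
    apply hy5
    exact linkV_eq_iff.mpr ⟨rfl, rfl, by cases c <;> cases c₅ <;> simp_all⟩
  have hN : G.neighborFinset u = {w, w₅} := by
    symm
    apply Finset.eq_of_subset_of_card_le
    · intro x hx
      rw [Finset.mem_insert, Finset.mem_singleton] at hx
      rw [SimpleGraph.mem_neighborFinset]
      rcases hx with rfl | rfl
      · exact hp
      · exact h₅'
    · rw [SimpleGraph.card_neighborFinset_eq_degree, Finset.card_pair hw5.symm]
      exact hd
  -- `v₂ ~ (u, w, c)` and `v₂ ≠ m(S)`: `v₂` is the connection partner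
  rcases (adj_linkV_iff _ _).mp h₁ with ⟨S₂, rfl, hc2⟩ | rfl
  · apply hx2
    simp only at hc2
    rw [mid_eq_lowMid hN hp h₅' hw5.symm S c (Or.inl hc), mid_eq_lowMid hN hp h₅' hw5.symm S₂ c (Or.inl hc2)]
  · -- `v₃ ~ conn`, `v₃ ≠ (u, w, c)`: `v₃` is a middle vertex of `w`; then `v₄` is a link of `w`
    rcases (adj_linkV_iff _ _).mp h₂ with ⟨S₃, rfl, hc3⟩ | h3
    · obtain ⟨w₄, h₄', c₄, rfl, hc4⟩ := (adj_midV_iff _ _ _).mp h₃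
      -- `v₄ ~ v₅` (link–link): `v₅ = conn v₄`, whose base pair is `(w₄, w)`; so `w₅ = w`
      have h45 := (adj_linkV_linkV _ _).mp h₄
      have e1 : (u, w₅) = (w₄, w) := by
        have := congrArg (fun y => y.1.1) h45
        simpa only [conn_fst] using this
      exact hw5 (Prod.mk.inj e1).2
    · rw [conn_conn] at h3
      exact hy3 h3.symm

/-- Symmetric form. [cite: ChenFlumLiu2025, Lemma 3.1 and Lemma 7.12] -/
theorem not_sixCycleThrough_linkV_midV_of_degree_le_two {u : Fin v} (hd : G.degree u ≤ 2)
    (S : {S : Finset (Fin v) // S ⊆ G.neighborFinset u ∧ Even S.card}) (p : CFIDart G) (c : Bool)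
    (hadj : (cfiGraph G T).Adj (linkV (p, c)) (midV ⟨u, S⟩)) :
    ¬ SixCycleThrough (cfiGraph G T) (linkV (p, c)) (midV ⟨u, S⟩) := fun h =>
  not_sixCycleThrough_midV_linkV_of_degree_le_two hd S p c hadj.symm h.symm

/-! ### Rigid edges: the summary used by the separating algorithm -/

/-- **An edge of `CFI(G, T)` lies on a six-cycle iff it is a gadget edge over a base vertex of
degree `≥ 3`**, i.e. iff its endpoints have the same base vertex of degree `≥ 3`.
[cite: ChenFlumLiu2025, Lemma 3.1, Lemma 7.12, §8] -/
theorem sixCycleThrough_iff_of_adj {x y : CFIVertex G} (h : (cfiGraph G T).Adj x y) :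
    SixCycleThrough (cfiGraph G T) x y ↔ base x = base y ∧ 3 ≤ G.degree (base x) := by
  rcases linkV_or_midV x with ⟨x, rfl⟩ | ⟨⟨u, S⟩, rfl⟩
  · rcases (adj_linkV_iff x y).mp h with ⟨S, rfl, hc⟩ | rfl
    · -- link–middle (gadget edge)
      obtain ⟨⟨⟨u, w⟩, hp⟩, c⟩ := x
      simp only [base_linkV, base_midV, true_and]
      constructor
      · intro h6
        by_contra hlt
        exact not_sixCycleThrough_linkV_midV_of_degree_le_two (Nat.le_of_lt_succ (Nat.lt_of_not_le hlt)) S _ c h h6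
      · intro h3
        exact sixCycleThrough_linkV_midV h3 S _ c h
    · -- connection edge
      constructor
      · intro h6
        exact absurd h6 (not_sixCycleThrough_conn x)
      · rintro ⟨hb, -⟩
        exact absurd hb.symm (base_conn_ne x)
  · obtain ⟨w, hw, c, rfl, hc⟩ := (adj_midV_iff u S y).mp h
    simp only [base_linkV, base_midV, true_and]
    constructor
    · intro h6
      by_contra hlt
      exact not_sixCycleThrough_midV_linkV_of_degree_le_two (Nat.le_of_lt_succ (Nat.lt_of_not_le hlt)) S _ c h h6
    · intro h3
      exact sixCycleThrough_midV_linkV h3 S _ c h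

end Graph

end Literature.ModelTheory.FiniteModelTheory
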